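import Summits.QuantumFields.BalabanUV.Beta.D1BFx.ShellWindowInterface

/-!
# `BalabanUV.Beta.D1BFx.ShellWindowLegs` — road «BF-x» for binder row D1, sub-leaf C3-SHELL (part 2 of 3):
# THE WALL FROM SHELL-ℓ¹ LEG ROWS — leg level (one pointwise-good leg per pair) and THE END

HONEST DEPENDENCY (page 1, mandatory): continuum YM on T⁴ ⇐ BetaPertH ∧ nine spine estimates (0/9 proved); BetaPertH ⇐ (D1) ∧
(D4) ∧ CAP+tail; G-an2-4 gates asym, D1 and NE2/3/4.  HONEST FRAMING (cell contract, verbatim): «discharging `BetaPertH` makes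
Bałaban's UV stability UNCONDITIONAL — a real constructive-QFT result; it is NOT the continuum limit and NOT the Clay problem.»
THIS MODULE DISCHARGES NOTHING of the wall: [folklore] bookkeeping about ARBITRARY functions `ℤ⁴ → ℝ` and arbitrary `BubbleTransfer.Leg`
tables, composed BY NAME from part 1 (`D1BFx/ShellWindowInterface`: `oneLoopDrift_of_windowSumPow_identity`, `tail_sum_le_shell`,
`window_sub_le_of_shellRows`, `windowSum_of_split`) and `ComposedRoad.abs_convexComb_sub_le`.  No `def`, no `Prop` mirror, no cited
fact, 0 sorry.  Bookkeeping for ONE road (BF-x) to ONE conjunct (D1); 0 wall binders instantiated; NOT D1, NOT `BetaPertH`, NOT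
continuum, NOT Clay.

ABSOLUTE RULE (cell charter, verbatim): «No internally-minted statement may enter as a cited fact. Every hypothesis is either
kernel-proved in this package or a verbatim quotation of a PUBLISHED theorem with page reference. The manuscript(s) under audit are NOT
citable for their own disputed steps — they are the thing under adjudication; programme-internal (2001/route/tribunal) claims are never
citable.»  Accordingly nothing below is a statement about Bałaban's kernels; every hypothesis is a free binder on abstract families.

WHY: see part 1's header (the wall keeps only WINDOW SUMS of `K − K⁰` and of the tail; on gen-3's evidence the pointwise (W2′) row of a
degree-4 leg is off by `log n` on the block-edge layer while its shell sums are not).  Here ONE leg per degree-6 pair is designated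
pointwise-good (`i ∈ sF`: the first; `i ∉ sF`: the second — in an3's realised table every pair has a leg of degree ≤ 3) and keeps
its POINTWISE row; the other leg is asked ONLY for SHELL SUMS.  Every leg carries exactly ONE row.
* §4 (ONE SHELL) `pow_le_pow_trunc_mul_sq`, `abs_leg_le_of_row`, `shell_product_le` (window: pointwise (W2′) row
  `|F − f| ≤ R/(‖w‖∞^{a−2}n²)` on the good leg, SHELL row `Σ_shell|G − g| ≤ S(r+1)⁴/((r+1)^b·n)` on the other ⟹
  `(r+1)²Σ_shell|FG − fg| ≤ ((A_P+B_P+R)S + 80R(A_Q+B_Q))/n`), `shell_tail_product_le` (`|F| ≤ R′(r+1)^{−a}` pointwise,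
  `Σ_shell|G| ≤ 80S′(r+1)³(r+1)^{−b}ε` ⟹ `(r+1)²Σ_shell|FG| ≤ 80R′S′(r+1)⁻¹ε`), `abs_moment_le_shell`, the table sums
  `shellWindow_of_legRows`, `shellTail_of_legRows` (mirror cases by swapping the factors).
* COMPANION part 3 `D1BFx/ShellWindowEnd`: THE END `oneLoopDrift_of_shellLegRowsPow_identity_avg` (one row per leg, base-point-averaged
  identification, along `n = Lc^m`, identity shape ⟹ drift), strictly MORE GENERAL than the tree's END.
NOT HERE: the END (part 3 `D1BFx/ShellWindowEnd`); that any actual leg satisfies the shell rows (analytic, a later leaf); the scalar-leg END /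
C3 twin (`D1BFx/ShellGradedRoad`).
Unit `b2b-balaban-beta-d1-formalise-leaf-07` (gen 4), D1 formalisation swarm; `LEAVES-BFx.md` sub-row C3-SHELL; journal CLAIM l.11259.
-/

namespace Summit.QuantumFields.BalabanUV.Beta.D1BFx.ShellWindowLegs

open Finset
open scoped BigOperators
open Literature.Probability.LatticeModels (annulus)
open Literature.MathematicalPhysics.QuantumFieldTheory.Balaban1983to89
open Literature.MathematicalPhysics.QuantumFieldTheory.Balaban1983to89.FlowStep (HBeta)
open Literature.MathematicalPhysics.QuantumFieldTheory.Balaban1983to89.Beta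
open Literature.MathematicalPhysics.QuantumFieldTheory.Balaban1983to89.Beta.TransverseStructure (E4)
open Literature.MathematicalPhysics.QuantumFieldTheory.Balaban1983to89.Beta.LeadingCoefficient (leadingIntegrand kappaBal
  transverseValue)
open Literature.MathematicalPhysics.QuantumFieldTheory.Balaban1983to89.Beta.DyadicShell (Pt toReal supNorm mem_annulus_iff
  ne_zero_of_mem_annulus supNorm_eq_of_mem_sphere)
open Literature.MathematicalPhysics.QuantumFieldTheory.Balaban1983to89.Beta.LargeLWindow.WindowDecomposition (constA)
open Literature.MathematicalPhysics.QuantumFieldTheory.Balaban1983to89.Beta.BubbleTransfer (Leg lattBubble contBubble bubbleConst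
  abs_moment_le)
open Literature.MathematicalPhysics.QuantumFieldTheory.Balaban1983to89.Beta.Drift (OneLoopDrift)
open Literature.MathematicalPhysics.QuantumFieldTheory.Balaban1983to89.Beta.MarginalTelescoping (composedCoeff IdentityForm)

noncomputable section

/-! ## §4 Leg level, one shell: the good leg pointwise, the other leg by shell sums -/

section LegShell

open Literature.MathematicalPhysics.QuantumFieldTheory.Balaban1983to89.Beta.WindowInterface (four_le_deg_right)
open Literature.MathematicalPhysics.QuantumFieldTheory.Balaban1983to89.Beta.TransferUV (card_annulus_succ_four_le)

/-- [folklore] Exponent bookkeeping with truncated subtraction: `1 ≤ s ≤ n` ⟹ `s^a ≤ s^{a−2}·n²` (for `a ≥ 2` this is `s² ≤ n²`; for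
`a < 2`, `a − 2 = 0` and `s^a ≤ s² ≤ n²`). -/
theorem pow_le_pow_trunc_mul_sq {s n : ℝ} (a : ℕ) (hs : 1 ≤ s) (hsn : s ≤ n) : s ^ a ≤ s ^ (a - 2) * n ^ 2 := by
  have hs0 : 0 ≤ s := by linarith
  by_cases ha : 2 ≤ a
  · calc s ^ a = s ^ (a - 2) * s ^ 2 := by rw [← pow_add, Nat.sub_add_cancel ha]
      _ ≤ s ^ (a - 2) * n ^ 2 := mul_le_mul_of_nonneg_left (pow_le_pow_left₀ hs0 hsn 2) (by positivity)
  · have ha' : a - 2 = 0 := by omega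
    rw [ha', pow_zero, one_mul]
    calc s ^ a ≤ s ^ 2 := pow_le_pow_right₀ hs (by omega)
      _ ≤ n ^ 2 := pow_le_pow_left₀ hs0 hsn 2

/-- [folklore] On the window, a pointwise (W2′) row makes the ACTUAL leg table-sized: `|F w| ≤ (A + B + R)/‖w‖∞^a` (`1 ≤ ‖w‖∞ ≤ n`). -/
theorem abs_leg_le_of_row (Pl : Leg) {n L k : ℕ} {w : Pt} (hw : w ≠ 0) (hwn : (supNorm w : ℝ) ≤ n) {F : Pt → ℝ} {R : ℝ}
    (hR : 0 ≤ R) (hF : |F w - Pl.f L k w| ≤ R / ((supNorm w : ℝ) ^ (Pl.a - 2) * (n : ℝ) ^ 2)) :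
    |F w| ≤ (Pl.A + Pl.B + R) / (supNorm w : ℝ) ^ Pl.a := by
  have hs : (1 : ℝ) ≤ supNorm w := Leg.one_le_supNorm hw
  have hs0 : (0 : ℝ) < supNorm w := by linarith
  have hf := Pl.abs_f_le L k hw
  have hpow := pow_le_pow_trunc_mul_sq Pl.a hs hwn
  have hF' : |F w - Pl.f L k w| ≤ R / (supNorm w : ℝ) ^ Pl.a :=
    hF.trans (div_le_div_of_nonneg_left hR (pow_pos hs0 _) hpow)
  calc |F w| = |Pl.f L k w + (F w - Pl.f L k w)| := by ring_nf
    _ ≤ |Pl.f L k w| + |F w - Pl.f L k w| := abs_add_le _ _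
    _ ≤ (Pl.A + Pl.B) / (supNorm w : ℝ) ^ Pl.a + R / (supNorm w : ℝ) ^ Pl.a := add_le_add hf hF'
    _ = (Pl.A + Pl.B + R) / (supNorm w : ℝ) ^ Pl.a := by ring

/-- [folklore] **ONE INDEX, ONE SHELL OF THE WINDOW, FIRST LEG POINTWISE-GOOD** (`a + b = 6`, shell `‖w‖∞ = r+1 ≤ n`): the pointwise
(W2′) row `|F − f| ≤ R/(‖w‖∞^{a−2}n²)` and the SHELL row `Σ_shell|G − g| ≤ S(r+1)⁴/((r+1)^b·n)` ⟹
`(r+1)²·Σ_shell|FG − fg| ≤ ((A_P+B_P+R)S + 80R(A_Q+B_Q))/n` (`FG − fg = F(G − g) + (F − f)g`; `sup_shell|F| ≤ (A_P+B_P+R)(r+1)^{−a}`,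
`sup_shell|g| ≤ (A_Q+B_Q)(r+1)^{−b}`, `#shell ≤ 80(r+1)³`, `(r+1)⁴ ≤ (r+1)^{a−2}(r+1)^b`).  Mirror case: swap the factors. -/
theorem shell_product_le (Pl Ql : Leg) (hdeg : Pl.a + Ql.a = 6) {n L k r : ℕ} (hrn : r + 1 ≤ n)
    {F G : Pt → ℝ} {R S : ℝ} (hR : 0 ≤ R)
    (hFpt : ∀ w ∈ annulus 4 r (r + 1), |F w - Pl.f L k w| ≤ R / ((supNorm w : ℝ) ^ (Pl.a - 2) * (n : ℝ) ^ 2))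
    (hGsh : ∑ w ∈ annulus 4 r (r + 1), |G w - Ql.f L k w| ≤ S * ((r : ℝ) + 1) ^ 4 / (((r : ℝ) + 1) ^ Ql.a * n)) :
    ((r : ℝ) + 1) ^ 2 * ∑ w ∈ annulus 4 r (r + 1), |F w * G w - Pl.f L k w * Ql.f L k w| ≤
      ((Pl.A + Pl.B + R) * S + 80 * R * (Ql.A + Ql.B)) / n := by
  set t : ℝ := (r : ℝ) + 1 with ht
  have ht0 : 0 < t := by positivity
  have ht1 : 1 ≤ t := by rw [ht]; linarith [(Nat.cast_nonneg r : (0 : ℝ) ≤ r)]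
  have hn1 : (1 : ℝ) ≤ n := by exact_mod_cast (show 1 ≤ n by omega)
  have hn0 : (0 : ℝ) < n := by linarith
  have htn : t ≤ n := by rw [ht]; exact_mod_cast hrn
  have hAP := Pl.nonneg_A; have hBP := Pl.nonneg_B; have hAQ := Ql.nonneg_A; have hBQ := Ql.nonneg_B
  have hsup : ∀ w ∈ annulus 4 r (r + 1), (supNorm w : ℝ) = t := fun w hw => by
    rw [supNorm_eq_of_mem_sphere hw]; push_cast; ring
  -- pointwise sizes on the shell
  have hFw : ∀ w ∈ annulus 4 r (r + 1), |F w| ≤ (Pl.A + Pl.B + R) / t ^ Pl.a := fun w hw => by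
    have h := abs_leg_le_of_row Pl (ne_zero_of_mem_annulus hw) ((hsup w hw).symm ▸ htn) hR (hFpt w hw)
    rwa [hsup w hw] at h
  have hδFw : ∀ w ∈ annulus 4 r (r + 1), |F w - Pl.f L k w| ≤ R / (t ^ (Pl.a - 2) * (n : ℝ) ^ 2) := fun w hw => by
    have h := hFpt w hw
    rwa [hsup w hw] at h
  have hgw : ∀ w ∈ annulus 4 r (r + 1), |Ql.f L k w| ≤ (Ql.A + Ql.B) / t ^ Ql.a := fun w hw => by
    have h := Ql.abs_f_le L k (ne_zero_of_mem_annulus hw)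
    rwa [hsup w hw] at h
  -- the shell sum of the pointwise row: `#shell ≤ 80t³`
  have hFsh : ∑ w ∈ annulus 4 r (r + 1), |F w - Pl.f L k w| ≤ 80 * t ^ 3 * (R / (t ^ (Pl.a - 2) * (n : ℝ) ^ 2)) := by
    calc ∑ w ∈ annulus 4 r (r + 1), |F w - Pl.f L k w| ≤ ∑ _w ∈ annulus 4 r (r + 1), R / (t ^ (Pl.a - 2) * (n : ℝ) ^ 2) :=
          Finset.sum_le_sum hδFw
      _ = ((annulus 4 r (r + 1)).card : ℝ) * (R / (t ^ (Pl.a - 2) * (n : ℝ) ^ 2)) := by rw [Finset.sum_const, nsmul_eq_mul]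
      _ ≤ 80 * t ^ 3 * (R / (t ^ (Pl.a - 2) * (n : ℝ) ^ 2)) :=
          mul_le_mul_of_nonneg_right (card_annulus_succ_four_le r) (by positivity)
  -- termwise: |FG − fg| ≤ sup|F|·|G − g| + sup|g|·|F − f|
  have hterm : ∀ w ∈ annulus 4 r (r + 1), |F w * G w - Pl.f L k w * Ql.f L k w| ≤
      (Pl.A + Pl.B + R) / t ^ Pl.a * |G w - Ql.f L k w| + (Ql.A + Ql.B) / t ^ Ql.a * |F w - Pl.f L k w| := by
    intro w hw
    have e : F w * G w - Pl.f L k w * Ql.f L k w = F w * (G w - Ql.f L k w) + (F w - Pl.f L k w) * Ql.f L k w := by ring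
    rw [e]
    calc |F w * (G w - Ql.f L k w) + (F w - Pl.f L k w) * Ql.f L k w|
        ≤ |F w * (G w - Ql.f L k w)| + |(F w - Pl.f L k w) * Ql.f L k w| := abs_add_le _ _
      _ = |F w| * |G w - Ql.f L k w| + |Ql.f L k w| * |F w - Pl.f L k w| := by rw [abs_mul, abs_mul]; ring
      _ ≤ (Pl.A + Pl.B + R) / t ^ Pl.a * |G w - Ql.f L k w| + (Ql.A + Ql.B) / t ^ Ql.a * |F w - Pl.f L k w| :=
          add_le_add (mul_le_mul_of_nonneg_right (hFw w hw) (abs_nonneg _))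
            (mul_le_mul_of_nonneg_right (hgw w hw) (abs_nonneg _))
  have hsum : ∑ w ∈ annulus 4 r (r + 1), |F w * G w - Pl.f L k w * Ql.f L k w| ≤
      (Pl.A + Pl.B + R) / t ^ Pl.a * (S * t ^ 4 / (t ^ Ql.a * n)) +
        (Ql.A + Ql.B) / t ^ Ql.a * (80 * t ^ 3 * (R / (t ^ (Pl.a - 2) * (n : ℝ) ^ 2))) := by
    calc ∑ w ∈ annulus 4 r (r + 1), |F w * G w - Pl.f L k w * Ql.f L k w|
        ≤ ∑ w ∈ annulus 4 r (r + 1), ((Pl.A + Pl.B + R) / t ^ Pl.a * |G w - Ql.f L k w| +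
            (Ql.A + Ql.B) / t ^ Ql.a * |F w - Pl.f L k w|) := Finset.sum_le_sum hterm
      _ = (Pl.A + Pl.B + R) / t ^ Pl.a * ∑ w ∈ annulus 4 r (r + 1), |G w - Ql.f L k w| +
            (Ql.A + Ql.B) / t ^ Ql.a * ∑ w ∈ annulus 4 r (r + 1), |F w - Pl.f L k w| := by
          rw [Finset.sum_add_distrib, Finset.mul_sum, Finset.mul_sum]
      _ ≤ _ := add_le_add (mul_le_mul_of_nonneg_left hGsh (by positivity)) (mul_le_mul_of_nonneg_left hFsh (by positivity))
  -- algebra: `t^a·t^b = t^6`, `t^4 ≤ t^{a−2}·t^b`, `t ≤ n`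
  have h6 : t ^ Pl.a * t ^ Ql.a = t ^ 6 := by rw [← pow_add, hdeg]
  have e1 : t ^ 2 * ((Pl.A + Pl.B + R) / t ^ Pl.a * (S * t ^ 4 / (t ^ Ql.a * n))) = (Pl.A + Pl.B + R) * S / n := by
    have hta : t ^ Pl.a ≠ 0 := pow_ne_zero _ ht0.ne'
    have htb : t ^ Ql.a ≠ 0 := pow_ne_zero _ ht0.ne'
    field_simp
    rw [← h6]
    ring
  have h4 : t ^ 4 ≤ t ^ (Pl.a - 2) * t ^ Ql.a := by
    rw [← pow_add]; exact pow_le_pow_right₀ ht1 (four_le_deg_right hdeg)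
  have e2 : t ^ 2 * ((Ql.A + Ql.B) / t ^ Ql.a * (80 * t ^ 3 * (R / (t ^ (Pl.a - 2) * (n : ℝ) ^ 2)))) ≤
      80 * R * (Ql.A + Ql.B) / n := by
    have hq : 0 < t ^ (Pl.a - 2) * t ^ Ql.a := by positivity
    calc t ^ 2 * ((Ql.A + Ql.B) / t ^ Ql.a * (80 * t ^ 3 * (R / (t ^ (Pl.a - 2) * (n : ℝ) ^ 2))))
        = 80 * R * (Ql.A + Ql.B) * (t ^ 4 / (t ^ (Pl.a - 2) * t ^ Ql.a)) * (t / ((n : ℝ) * n)) := by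
          field_simp
      _ ≤ 80 * R * (Ql.A + Ql.B) * 1 * (1 / n) := by
          apply mul_le_mul _ _ (by positivity) (by positivity)
          · exact mul_le_mul_of_nonneg_left ((div_le_one hq).mpr h4) (by positivity)
          · rw [div_le_div_iff₀ (by positivity) hn0]
            nlinarith
      _ = 80 * R * (Ql.A + Ql.B) / n := by ring
  calc t ^ 2 * ∑ w ∈ annulus 4 r (r + 1), |F w * G w - Pl.f L k w * Ql.f L k w|
      ≤ t ^ 2 * ((Pl.A + Pl.B + R) / t ^ Pl.a * (S * t ^ 4 / (t ^ Ql.a * n)) +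
          (Ql.A + Ql.B) / t ^ Ql.a * (80 * t ^ 3 * (R / (t ^ (Pl.a - 2) * (n : ℝ) ^ 2)))) :=
        mul_le_mul_of_nonneg_left hsum (by positivity)
    _ = t ^ 2 * ((Pl.A + Pl.B + R) / t ^ Pl.a * (S * t ^ 4 / (t ^ Ql.a * n))) +
          t ^ 2 * ((Ql.A + Ql.B) / t ^ Ql.a * (80 * t ^ 3 * (R / (t ^ (Pl.a - 2) * (n : ℝ) ^ 2)))) := by ring
    _ ≤ (Pl.A + Pl.B + R) * S / n + 80 * R * (Ql.A + Ql.B) / n := by rw [e1]; exact add_le_add le_rfl e2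
    _ = ((Pl.A + Pl.B + R) * S + 80 * R * (Ql.A + Ql.B)) / n := by ring

/-- [folklore] **ONE INDEX, ONE EXTERIOR SHELL, FIRST LEG POINTWISE-GOOD**: `|F| ≤ R′(r+1)^{−a}` pointwise and
`Σ_shell|G| ≤ 80S′(r+1)³(r+1)^{−b}·ε` (`ε` the common scale factor, e.g. `e^{−(δ/n)(r+1)}`) ⟹ `(r+1)²·Σ_shell|FG| ≤ 80R′S′(r+1)⁻¹ε`. -/
theorem shell_tail_product_le (Pl Ql : Leg) (hdeg : Pl.a + Ql.a = 6) {r : ℕ} {F G : Pt → ℝ} {R' S' ε : ℝ} (hR' : 0 ≤ R')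
    (hFpt : ∀ w ∈ annulus 4 r (r + 1), |F w| ≤ R' / ((r : ℝ) + 1) ^ Pl.a)
    (hGsh : ∑ w ∈ annulus 4 r (r + 1), |G w| ≤ 80 * S' * ((r : ℝ) + 1) ^ 3 / ((r : ℝ) + 1) ^ Ql.a * ε) :
    ((r : ℝ) + 1) ^ 2 * ∑ w ∈ annulus 4 r (r + 1), |F w * G w| ≤ 80 * (R' * S') / ((r : ℝ) + 1) * ε := by
  set t : ℝ := (r : ℝ) + 1 with ht
  have ht0 : 0 < t := by positivity
  have hsum : ∑ w ∈ annulus 4 r (r + 1), |F w * G w| ≤ R' / t ^ Pl.a * (80 * S' * t ^ 3 / t ^ Ql.a * ε) := by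
    calc ∑ w ∈ annulus 4 r (r + 1), |F w * G w| ≤ ∑ w ∈ annulus 4 r (r + 1), R' / t ^ Pl.a * |G w| := by
          refine Finset.sum_le_sum fun w hw => ?_
          rw [abs_mul]
          exact mul_le_mul_of_nonneg_right (hFpt w hw) (abs_nonneg _)
      _ = R' / t ^ Pl.a * ∑ w ∈ annulus 4 r (r + 1), |G w| := by rw [Finset.mul_sum]
      _ ≤ R' / t ^ Pl.a * (80 * S' * t ^ 3 / t ^ Ql.a * ε) := mul_le_mul_of_nonneg_left hGsh (by positivity)
  have h6 : t ^ Pl.a * t ^ Ql.a = t ^ 6 := by rw [← pow_add, hdeg]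
  have hkey : t ^ 2 * (R' / t ^ Pl.a * (80 * S' * t ^ 3 / t ^ Ql.a * ε)) = 80 * (R' * S') / t * ε := by
    have hta : t ^ Pl.a ≠ 0 := pow_ne_zero _ ht0.ne'
    have htb : t ^ Ql.a ≠ 0 := pow_ne_zero _ ht0.ne'
    have e1 : R' / t ^ Pl.a * (80 * S' * t ^ 3 / t ^ Ql.a * ε) = 80 * (R' * S') * t ^ 3 * ε / t ^ 6 := by
      rw [← h6]; field_simp
    rw [e1]
    field_simp
  calc t ^ 2 * ∑ w ∈ annulus 4 r (r + 1), |F w * G w| ≤ t ^ 2 * (R' / t ^ Pl.a * (80 * S' * t ^ 3 / t ^ Ql.a * ε)) :=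
        mul_le_mul_of_nonneg_left hsum (by positivity)
    _ = 80 * (R' * S') / t * ε := hkey

variable {ι : Type*} {s : Finset ι} {cc₀ : ι → ℝ} {P Q : ι → Leg}

/-- [folklore] The moment weight on the shell `‖w‖∞ = r+1`: `|w_μw_ν| ≤ (r+1)²`. -/
theorem abs_moment_le_shell (μ ν : Fin 4) {r : ℕ} {w : Pt} (hw : w ∈ annulus 4 r (r + 1)) :
    |toReal w μ * toReal w ν| ≤ ((r : ℝ) + 1) ^ 2 := by
  have hsup : (supNorm w : ℝ) = (r : ℝ) + 1 := by rw [supNorm_eq_of_mem_sphere hw]; push_cast; ring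
  rw [← hsup]
  exact abs_moment_le μ ν w

/-- [folklore] **THE TABLE, ONE SHELL OF THE WINDOW.**  Designated subset `sF` (first leg pointwise-good; on the complement the second
leg is); the designated leg carries its pointwise (W2′) row, the other leg its SHELL row ⟹
`Σ_{‖w‖∞=r+1}|w_μw_ν·Σ_i c_i(F_iG_i − f_ig_i)| ≤ D/n`, `D = Σ_i|c_i|(80((A_P+B_P)S_i + R_i(A_Q+B_Q)) + R_iS_i)`. -/
theorem shellWindow_of_legRows (hdeg : ∀ i ∈ s, (P i).a + (Q i).a = 6) (μ ν : Fin 4) (sF : Finset ι) {n L k r : ℕ}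
    (hrn : r + 1 ≤ n) {F G : ι → Pt → ℝ} {R S : ι → ℝ} (hR : ∀ i ∈ s, 0 ≤ R i) (hS : ∀ i ∈ s, 0 ≤ S i)
    (hFpt : ∀ i ∈ s, i ∈ sF → ∀ w ∈ annulus 4 r (r + 1),
      |F i w - (P i).f L k w| ≤ R i / ((supNorm w : ℝ) ^ ((P i).a - 2) * (n : ℝ) ^ 2))
    (hGsh : ∀ i ∈ s, i ∈ sF → ∑ w ∈ annulus 4 r (r + 1), |G i w - (Q i).f L k w| ≤
      S i * ((r : ℝ) + 1) ^ 4 / (((r : ℝ) + 1) ^ (Q i).a * n))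
    (hGpt : ∀ i ∈ s, i ∉ sF → ∀ w ∈ annulus 4 r (r + 1),
      |G i w - (Q i).f L k w| ≤ S i / ((supNorm w : ℝ) ^ ((Q i).a - 2) * (n : ℝ) ^ 2))
    (hFsh : ∀ i ∈ s, i ∉ sF → ∑ w ∈ annulus 4 r (r + 1), |F i w - (P i).f L k w| ≤
      R i * ((r : ℝ) + 1) ^ 4 / (((r : ℝ) + 1) ^ (P i).a * n)) :
    ∑ w ∈ annulus 4 r (r + 1), |toReal w μ * toReal w ν * ∑ i ∈ s, cc₀ i * (F i w * G i w - (P i).f L k w * (Q i).f L k w)| ≤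
      (∑ i ∈ s, |cc₀ i| * (80 * (((P i).A + (P i).B) * S i + R i * ((Q i).A + (Q i).B)) + R i * S i)) / n := by
  set t : ℝ := (r : ℝ) + 1 with ht
  have ht0 : 0 < t := by positivity
  have hn0 : (0 : ℝ) < n := by exact_mod_cast (show 0 < n by omega)
  -- per index: `(r+1)²·Σ_shell|F_iG_i − f_ig_i| ≤ D_i/n`, by `shell_product_le` or its mirror
  have hidx : ∀ i ∈ s, t ^ 2 * ∑ w ∈ annulus 4 r (r + 1), |F i w * G i w - (P i).f L k w * (Q i).f L k w| ≤
      (80 * (((P i).A + (P i).B) * S i + R i * ((Q i).A + (Q i).B)) + R i * S i) / n := by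
    intro i hi
    have hAP := (P i).nonneg_A; have hBP := (P i).nonneg_B; have hAQ := (Q i).nonneg_A; have hBQ := (Q i).nonneg_B
    have hRi := hR i hi; have hSi := hS i hi
    by_cases hF : i ∈ sF
    · refine (shell_product_le (P i) (Q i) (hdeg i hi) hrn hRi (hFpt i hi hF) (hGsh i hi hF)).trans ?_
      apply div_le_div_of_nonneg_right _ hn0.le
      nlinarith [mul_nonneg (add_nonneg hAP hBP) hSi, mul_nonneg hRi hSi]
    · have hdeg' : (Q i).a + (P i).a = 6 := by rw [add_comm]; exact hdeg i hi
      have h := shell_product_le (Q i) (P i) hdeg' hrn hSi (hGpt i hi hF) (hFsh i hi hF)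
      have e : ∀ w, |G i w * F i w - (Q i).f L k w * (P i).f L k w| = |F i w * G i w - (P i).f L k w * (Q i).f L k w| :=
        fun w => by rw [mul_comm (G i w), mul_comm ((Q i).f L k w)]
      simp_rw [e] at h
      refine h.trans (div_le_div_of_nonneg_right ?_ hn0.le)
      nlinarith [mul_nonneg (add_nonneg hAQ hBQ) hRi, mul_nonneg hRi hSi]
  calc ∑ w ∈ annulus 4 r (r + 1), |toReal w μ * toReal w ν * ∑ i ∈ s, cc₀ i * (F i w * G i w - (P i).f L k w * (Q i).f L k w)|
      ≤ ∑ w ∈ annulus 4 r (r + 1), t ^ 2 * ∑ i ∈ s, |cc₀ i| * |F i w * G i w - (P i).f L k w * (Q i).f L k w| := by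
        refine Finset.sum_le_sum fun w hw => ?_
        rw [abs_mul]
        refine mul_le_mul (abs_moment_le_shell μ ν hw) ?_ (abs_nonneg _) (by positivity)
        refine (Finset.abs_sum_le_sum_abs _ _).trans (le_of_eq (Finset.sum_congr rfl fun i _ => ?_))
        rw [abs_mul]
    _ = ∑ i ∈ s, |cc₀ i| * (t ^ 2 * ∑ w ∈ annulus 4 r (r + 1), |F i w * G i w - (P i).f L k w * (Q i).f L k w|) := by
        simp only [Finset.mul_sum]
        rw [Finset.sum_comm]
        exact Finset.sum_congr rfl fun i _ => Finset.sum_congr rfl fun w _ => by ring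
    _ ≤ ∑ i ∈ s, |cc₀ i| * ((80 * (((P i).A + (P i).B) * S i + R i * ((Q i).A + (Q i).B)) + R i * S i) / n) :=
        Finset.sum_le_sum fun i hi => mul_le_mul_of_nonneg_left (hidx i hi) (abs_nonneg _)
    _ = (∑ i ∈ s, |cc₀ i| * (80 * (((P i).A + (P i).B) * S i + R i * ((Q i).A + (Q i).B)) + R i * S i)) / n := by
        rw [Finset.sum_div]
        exact Finset.sum_congr rfl fun i _ => by ring

/-- [folklore] **THE TABLE, ONE EXTERIOR SHELL.**  The designated leg carries its pointwise power tail, the other leg its SHELL row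
with the common scale factor `ε` ⟹ `Σ_{‖w‖∞=r+1}|w_μw_ν·Σ_i c_iF_iG_i| ≤ 80E(r+1)⁻¹ε`, `E = Σ_i|c_i|R′_iS′_i`. -/
theorem shellTail_of_legRows (hdeg : ∀ i ∈ s, (P i).a + (Q i).a = 6) (μ ν : Fin 4) (sF : Finset ι) {r : ℕ}
    {F G : ι → Pt → ℝ} {R' S' : ι → ℝ} {ε : ℝ} (hR' : ∀ i ∈ s, 0 ≤ R' i) (hS' : ∀ i ∈ s, 0 ≤ S' i)
    (hFpt : ∀ i ∈ s, i ∈ sF → ∀ w ∈ annulus 4 r (r + 1), |F i w| ≤ R' i / ((r : ℝ) + 1) ^ (P i).a)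
    (hGsh : ∀ i ∈ s, i ∈ sF → ∑ w ∈ annulus 4 r (r + 1), |G i w| ≤
      80 * S' i * ((r : ℝ) + 1) ^ 3 / ((r : ℝ) + 1) ^ (Q i).a * ε)
    (hGpt : ∀ i ∈ s, i ∉ sF → ∀ w ∈ annulus 4 r (r + 1), |G i w| ≤ S' i / ((r : ℝ) + 1) ^ (Q i).a)
    (hFsh : ∀ i ∈ s, i ∉ sF → ∑ w ∈ annulus 4 r (r + 1), |F i w| ≤
      80 * R' i * ((r : ℝ) + 1) ^ 3 / ((r : ℝ) + 1) ^ (P i).a * ε) :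
    ∑ w ∈ annulus 4 r (r + 1), |toReal w μ * toReal w ν * ∑ i ∈ s, cc₀ i * (F i w * G i w)| ≤
      80 * (∑ i ∈ s, |cc₀ i| * (R' i * S' i)) / ((r : ℝ) + 1) * ε := by
  set t : ℝ := (r : ℝ) + 1 with ht
  have ht0 : 0 < t := by positivity
  have hidx : ∀ i ∈ s, t ^ 2 * ∑ w ∈ annulus 4 r (r + 1), |F i w * G i w| ≤ 80 * (R' i * S' i) / t * ε := by
    intro i hi
    by_cases hF : i ∈ sF
    · exact shell_tail_product_le (P i) (Q i) (hdeg i hi) (hR' i hi) (hFpt i hi hF) (hGsh i hi hF)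
    · have hdeg' : (Q i).a + (P i).a = 6 := by rw [add_comm]; exact hdeg i hi
      have h := shell_tail_product_le (Q i) (P i) hdeg' (hS' i hi) (hGpt i hi hF) (hFsh i hi hF)
      have e : ∀ w, |G i w * F i w| = |F i w * G i w| := fun w => by rw [mul_comm]
      simp_rw [e] at h
      refine h.trans (le_of_eq ?_)
      ring
  calc ∑ w ∈ annulus 4 r (r + 1), |toReal w μ * toReal w ν * ∑ i ∈ s, cc₀ i * (F i w * G i w)|
      ≤ ∑ w ∈ annulus 4 r (r + 1), t ^ 2 * ∑ i ∈ s, |cc₀ i| * |F i w * G i w| := by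
        refine Finset.sum_le_sum fun w hw => ?_
        rw [abs_mul]
        refine mul_le_mul (abs_moment_le_shell μ ν hw) ?_ (abs_nonneg _) (by positivity)
        refine (Finset.abs_sum_le_sum_abs _ _).trans (le_of_eq (Finset.sum_congr rfl fun i _ => ?_))
        rw [abs_mul]
    _ = ∑ i ∈ s, |cc₀ i| * (t ^ 2 * ∑ w ∈ annulus 4 r (r + 1), |F i w * G i w|) := by
        simp only [Finset.mul_sum]
        rw [Finset.sum_comm]
        exact Finset.sum_congr rfl fun i _ => Finset.sum_congr rfl fun w _ => by ring
    _ ≤ ∑ i ∈ s, |cc₀ i| * (80 * (R' i * S' i) / t * ε) :=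
        Finset.sum_le_sum fun i hi => mul_le_mul_of_nonneg_left (hidx i hi) (abs_nonneg _)
    _ = 80 * (∑ i ∈ s, |cc₀ i| * (R' i * S' i)) / t * ε := by
        rw [Finset.mul_sum, Finset.sum_div, Finset.sum_mul]
        exact Finset.sum_congr rfl fun i _ => by ring

end LegShell

end

end Summit.QuantumFields.BalabanUV.Beta.D1BFx.ShellWindowLegs
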